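import Literature.NumberTheory.Sieve.BombieriFriedlanderIwaniecLemma1Completion
import Literature.NumberTheory.Sieve.BombieriFriedlanderIwaniecTheorem10FromLemma1Corrected
import HarnessLib

/-!
# BFI 1986/2019: the whole cone from the off-diagonal Kloosterman sums of level `r` alone (`s = 1`)

Topic `Literature/NumberTheory/Sieve`.  Everything here is PROVED (theorems only; no definition, no
named fact, no hypothesis predicate).

## The point of this file

`…Lemma1Completion` reduces the corrected Lemma 1 of E. Bombieri, J. B. Friedlander, H. Iwaniec
(Acta Math. 156 (1986) §2 p. 210 = Deshouillers–Iwaniec, Invent. Math. 70 (1982), Theorem 12;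
corrected in arXiv:1903.01371 (2019), §2 Lemma 2.1) for the weight `w ⊗ w` to the bound for its
off-diagonal part `BFI.L1.Koff C D N R S H₀ B` — the frequencies `1 ≤ |h| ≤ H₀` after Poisson
summation in `d`, complete Kloosterman sums `𝓢_{sc}(h; n, r) = S(h, n r̄; sc)` — demanded for ALL
`S ≥ 1/2` (`BFI.lemma1BoundCorrected_plateau2_of_offdiag`, hypothesis quantified over `S`).

The BFI cone, however, consumes Lemma 1 only at `S = 1/2`, i.e. `s = 1` (BFI 2019, §2: "In most of
our uses of this lemma we have `S = 1`"; Lemma 6, §8 p. 227, and Lemma 7, §9, both apply Lemma 1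
with `s = 1`): in the tree, Theorems 1, 2, 5, 5*, 10, the fact `bfi_wellFactorable_level` and the
twin-prime sieve bound all follow from the single instance `BFI.K1HalfFor BFI.plateau2 (5/4)`
(`…Theorem1_of_k1Half`, `BFI.theorem2_of_k1Half`, `…Theorem5_of_k1Half`,
`BombieriFriedlanderIwaniecTheorem10_of_k1Half`, `twinSieve_bfi_of_k1Half`).  This file records the
corresponding sharpening of the reduction of `…Lemma1Completion`:

* `BFI.L1.norm_dispK_le_of_offdiag_at` — the completion argument of `…Lemma1Completion`
  (`BFI.L1.norm_dispK_le_of_offdiag`) POINTWISE in `S`: at a fixed `S ≥ 1/2`, the off-diagonal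
  bound at that `S` alone gives the corrected Lemma-1 bound at that `S` (same proof: the zero
  frequency `BFI.L1.norm_Kzero_le`, the tails `BFI.L1.tail_total_le` and the decomposition
  `BFI.L1.norm_dispK_sub_Kzero_sub_Koff_le` are already pointwise in `S`);
* `BFI.k1HalfFor_of_offdiag_half` — hence `BFI.K1HalfFor BFI.plateau2 (5/4)` from the off-diagonal
  bound at `S = 1/2` only;
* `BombieriFriedlanderIwaniecTheorem1_of_offdiag_half`, `…Theorem5_of_offdiag_half`,
  `…Theorem10_of_offdiag_half`, `bfi_wellFactorable_level_of_offdiag_half`,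
  `twinSieve_bfi_of_offdiag_half`.

At `S = 1/2` the sum over `s ∼ 1/2` is the single term `s = 1` (`BFI.L6.dyadic_half`), so the
remaining hypothesis concerns only
`𝓚♯ = ∑_{r∼R} ∑_{n≤N} B_{nr1} ∑_{c ≤ 5C/4, (r,c)=1} w(c/C) c⁻¹ ∑_{1≤h≤H₀} (Φ_c(h) 𝓢_c(h;n,r) + Φ_c(−h) 𝓢_c(−h;n,r))`
with `𝓢_c(h; n, r) = S(h, n r̄; c)` (`BFI.L1.kl_eq_kloostermanSum`): sums over the modulus `c`,
`(c, r) = 1`, of the Kloosterman sums attached to the cusp pair `∞, 0` of `Γ₀(r)` (Deshouillers–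
Iwaniec's `S_{∞,1/s}` at `s = 1`), bilinear in `(n, r)` — the input that Kuznetsov's formula and the
spectral large sieve for `Γ₀(r)` (Deshouillers–Iwaniec, Theorems 9–11) provide, and the only
unproved ingredient of the BFI cone after this file.

## References

* E. Bombieri, J. B. Friedlander, H. Iwaniec, *Some corrections to an old paper*, arXiv:1903.01371
  (2019), §2 Lemma 2.1 ("In most of our uses of this lemma we have `S = 1`").
  [BombieriFriedlanderIwaniec2019]
* E. Bombieri, J. B. Friedlander, H. Iwaniec, Acta Math. 156 (1986), 203–251: §2 Lemma 1 p. 210;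
  §8 Lemma 6 p. 227; §8 Theorem 1 p. 225; §12 Theorem 5 p. 237; Theorem 10 p. 209.
  [BombieriFriedlanderIwaniecActa1986]
* J.-M. Deshouillers, H. Iwaniec, Invent. Math. 70 (1982), 219–288, Theorems 9–12, §9.
-/

noncomputable section

open Finset Real
open scoped ArithmeticFunction.sigma ContDiff FourierTransform ComplexConjugate

namespace Literature.NumberTheory.Sieve

namespace BFI

namespace L1

/-- **The completion step pointwise in `S`** (`BFI.L1.norm_dispK_le_of_offdiag` of
`…Lemma1Completion` with the off-diagonal hypothesis at ONE `S ≥ 1/2`): if for every `ε > 0` there is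
`K` with `‖𝓚♯(H₀)‖ ≤ K P^ε {CS(RS + N)(C + DR) + C²DS√((RS + N)R)}^{1/2} ‖B‖`,
`H₀ = ⌈2P^ε SC/D⌉`, `P = CDNRS`, for all `C, D, N ≥ 1`, `R ≥ 1/2` and all `B` at this `S`, then for
every `ε > 0` there is `K'` with
`‖𝓚(C, D, N, R, S)‖ ≤ K' P^ε {CS(RS + N)(C + DR) + C²DS√((RS + N)R) + D²NR}^{1/2} ‖B‖` at this `S`
(same proof: zero frequency `BFI.L1.norm_Kzero_le`, tails `BFI.L1.tail_total_le`, decomposition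
`BFI.L1.norm_dispK_sub_Kzero_sub_Koff_le`). [cite: BombieriFriedlanderIwaniec2019, §2 Lemma 2.1] -/
theorem norm_dispK_le_of_offdiag_at {S : ℝ} (hS : 1 / 2 ≤ S)
    (hoff : ∀ ε : ℝ, 0 < ε → ∃ K : ℝ, ∀ C D N R : ℝ, 1 ≤ C → 1 ≤ D → 1 ≤ N → 1 / 2 ≤ R →
      ∀ B : ℕ → ℕ → ℕ → ℂ,
        ‖Koff C D ⌊N⌋₊ R S ⌈2 * (C * D * N * R * S) ^ ε * S * C / D⌉₊ B‖ ≤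
          K * (C * D * N * R * S) ^ ε *
            Real.sqrt (C * S * (R * S + N) * (C + D * R) + C ^ 2 * D * S * Real.sqrt ((R * S + N) * R)) *
            lemma1Norm ⌊N⌋₊ R S B)
    {ε : ℝ} (hε : 0 < ε) :
    ∃ K' : ℝ, ∀ C D N R : ℝ, 1 ≤ C → 1 ≤ D → 1 ≤ N → 1 / 2 ≤ R →
      ∀ B : ℕ → ℕ → ℕ → ℂ,
        ‖dispK (fun c d => plateau2 (c / C) (d / D)) ⌊5 / 4 * C⌋₊ ⌊5 / 4 * D⌋₊ ⌊N⌋₊ R S B‖ ≤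
          K' * (C * D * N * R * S) ^ ε *
            Real.sqrt (C * S * (R * S + N) * (C + D * R) + C ^ 2 * D * S * Real.sqrt ((R * S + N) * R) +
              D ^ 2 * N * R) * lemma1Norm ⌊N⌋₊ R S B := by
  obtain ⟨K, hK⟩ := hoff ε hε
  obtain ⟨K₀, hK₀⟩ := norm_Kzero_le hε
  obtain ⟨Kt, hKt⟩ := tail_total_le hε
  refine ⟨max K 0 + max K₀ 0 + 2 * 4 ^ ε * max Kt 0, ?_⟩
  intro C D N R hC hD hN hR B
  have hD0 : 0 < D := by linarith
  have hS0 : 0 ≤ S := by linarith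
  have hR0 : 0 ≤ R := by linarith
  set P : ℝ := C * D * N * R * S with hP
  have hP0 : 0 < P := by positivity
  set H₀ : ℕ := ⌈2 * P ^ ε * S * C / D⌉₊ with hH₀
  set j : ℕ := ⌈6 / ε⌉₊ + 2 with hj
  have hj2 : 2 ≤ j := by omega
  set N' : ℕ := ⌊N⌋₊ with hN'
  set T₁ : ℝ := C * S * (R * S + N) * (C + D * R) with hT₁
  set T₂ : ℝ := C ^ 2 * D * S * Real.sqrt ((R * S + N) * R) with hT₂
  set Ic : ℝ := Real.sqrt (T₁ + T₂ + D ^ 2 * N * R) with hIc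
  have hT₁0 : 0 ≤ T₁ := by positivity
  have hT₂0 : 0 ≤ T₂ := by positivity
  have hnB : 0 ≤ lemma1Norm N' R S B := Real.sqrt_nonneg _
  have hPε : 0 ≤ P ^ ε := Real.rpow_nonneg hP0.le _
  -- the three pieces
  have h0 := hK₀ C D N R S hC hD hN hR hS B
  have h1 := hK C D N R hC hD hN hR B
  have h2 := (norm_dispK_sub_Kzero_sub_Koff_le (C := C) hD0 N' R hS0 H₀ hj2 B).trans
    (hKt C D N R S hC hD hN hR hS B)
  -- comparison of the three currencies with `Ic`
  have hI1 : D * Real.sqrt (N * R) ≤ Ic := by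
    rw [hIc, show D * Real.sqrt (N * R) = Real.sqrt (D ^ 2 * N * R) by
      rw [show D ^ 2 * N * R = D ^ 2 * (N * R) by ring, Real.sqrt_mul (sq_nonneg _), Real.sqrt_sq hD0.le]]
    exact Real.sqrt_le_sqrt (by linarith)
  have hDNR : 0 ≤ D ^ 2 * N * R := by positivity
  have hI2 : Real.sqrt (T₁ + T₂) ≤ Ic := Real.sqrt_le_sqrt (by linarith)
  have hI3 : 1 ≤ 2 * 4 ^ ε * (P ^ ε * Ic) := by
    -- `T₁ ≥ 1/2` so `Ic ≥ 1/√2 ≥ 1/2`, and `4^ε P^ε = (4P)^ε ≥ 1`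
    have hT₁half : 1 / 2 ≤ T₁ := by
      rw [hT₁]
      have h1 : 1 / 2 ≤ C * S := by nlinarith
      have h2 : 1 ≤ R * S + N := by nlinarith
      have h3 : 1 ≤ C + D * R := by nlinarith
      calc (1 / 2 : ℝ) = 1 / 2 * 1 * 1 := by ring
        _ ≤ C * S * (R * S + N) * (C + D * R) := by
            apply mul_le_mul (mul_le_mul h1 h2 (by norm_num) (by positivity)) h3 (by norm_num) (by positivity)
    have hIc_ge : 1 / 2 ≤ Ic := by
      rw [hIc]
      refine Real.le_sqrt_of_sq_le ?_
      have h14 : (1 / 2 : ℝ) ^ 2 = 1 / 4 := by norm_num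
      linarith
    have h4P : 1 ≤ 4 ^ ε * P ^ ε := by
      rw [← Real.mul_rpow (by norm_num) hP0.le]
      refine Real.one_le_rpow ?_ hε.le
      have hCD : 1 ≤ C * D := one_le_mul_of_one_le_of_one_le hC hD
      have hRS : 1 / 4 ≤ R * S := by
        have := mul_le_mul hR hS (by norm_num) hR0
        linarith
      have h1 : 1 * (1 / 4) ≤ (C * D * N) * (R * S) :=
        mul_le_mul (one_le_mul_of_one_le_of_one_le hCD hN) hRS (by norm_num) (by positivity)
      have h3 : P = (C * D * N) * (R * S) := by rw [hP]; ring
      rw [h3]; linarith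
    calc (1 : ℝ) = 2 * 1 * (1 / 2) := by ring
      _ ≤ 2 * (4 ^ ε * P ^ ε) * Ic := by
          apply mul_le_mul (mul_le_mul_of_nonneg_left h4P (by norm_num)) hIc_ge (by norm_num) (by positivity)
      _ = 2 * 4 ^ ε * (P ^ ε * Ic) := by ring
  -- triangle inequality
  have htri : ‖dispK (fun c d => plateau2 (c / C) (d / D)) ⌊5 / 4 * C⌋₊ ⌊5 / 4 * D⌋₊ N' R S B‖ ≤
      ‖Kzero C D N' R S B‖ + ‖Koff C D N' R S H₀ B‖ +
        ‖dispK (fun c d => plateau2 (c / C) (d / D)) ⌊5 / 4 * C⌋₊ ⌊5 / 4 * D⌋₊ N' R S B -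
          Kzero C D N' R S B - Koff C D N' R S H₀ B‖ := by
    set x := dispK (fun c d => plateau2 (c / C) (d / D)) ⌊5 / 4 * C⌋₊ ⌊5 / 4 * D⌋₊ N' R S B
    set y := Kzero C D N' R S B
    set z := Koff C D N' R S H₀ B
    calc ‖x‖ = ‖y + z + (x - y - z)‖ := by congr 1; ring
      _ ≤ ‖y + z‖ + ‖x - y - z‖ := norm_add_le _ _
      _ ≤ ‖y‖ + ‖z‖ + ‖x - y - z‖ := by linarith [norm_add_le y z]
  -- each piece against `P^ε Ic ‖B‖`
  have hA : ‖Kzero C D N' R S B‖ ≤ max K₀ 0 * (P ^ ε * Ic * lemma1Norm N' R S B) := by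
    refine h0.trans ?_
    calc K₀ * P ^ ε * (D * Real.sqrt (N * R)) * lemma1Norm N' R S B
        = K₀ * (P ^ ε * (D * Real.sqrt (N * R)) * lemma1Norm N' R S B) := by ring
      _ ≤ max K₀ 0 * (P ^ ε * (D * Real.sqrt (N * R)) * lemma1Norm N' R S B) :=
          mul_le_mul_of_nonneg_right (le_max_left _ _) (by positivity)
      _ ≤ max K₀ 0 * (P ^ ε * Ic * lemma1Norm N' R S B) := by
          refine mul_le_mul_of_nonneg_left ?_ (le_max_right _ _)
          exact mul_le_mul_of_nonneg_right (mul_le_mul_of_nonneg_left hI1 hPε) hnB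
  have hBoff : ‖Koff C D N' R S H₀ B‖ ≤ max K 0 * (P ^ ε * Ic * lemma1Norm N' R S B) := by
    refine h1.trans ?_
    calc K * P ^ ε * Real.sqrt (T₁ + T₂) * lemma1Norm N' R S B
        = K * (P ^ ε * Real.sqrt (T₁ + T₂) * lemma1Norm N' R S B) := by ring
      _ ≤ max K 0 * (P ^ ε * Real.sqrt (T₁ + T₂) * lemma1Norm N' R S B) :=
          mul_le_mul_of_nonneg_right (le_max_left _ _) (by positivity)
      _ ≤ max K 0 * (P ^ ε * Ic * lemma1Norm N' R S B) := by
          refine mul_le_mul_of_nonneg_left ?_ (le_max_right _ _)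
          exact mul_le_mul_of_nonneg_right (mul_le_mul_of_nonneg_left hI2 hPε) hnB
  have hCtail : ‖dispK (fun c d => plateau2 (c / C) (d / D)) ⌊5 / 4 * C⌋₊ ⌊5 / 4 * D⌋₊ N' R S B -
      Kzero C D N' R S B - Koff C D N' R S H₀ B‖ ≤
      2 * 4 ^ ε * max Kt 0 * (P ^ ε * Ic * lemma1Norm N' R S B) := by
    refine h2.trans ?_
    calc Kt * lemma1Norm N' R S B ≤ max Kt 0 * lemma1Norm N' R S B :=
          mul_le_mul_of_nonneg_right (le_max_left _ _) hnB
      _ = max Kt 0 * lemma1Norm N' R S B * 1 := (mul_one _).symm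
      _ ≤ max Kt 0 * lemma1Norm N' R S B * (2 * 4 ^ ε * (P ^ ε * Ic)) :=
          mul_le_mul_of_nonneg_left hI3 (by positivity)
      _ = 2 * 4 ^ ε * max Kt 0 * (P ^ ε * Ic * lemma1Norm N' R S B) := by ring
  calc ‖dispK (fun c d => plateau2 (c / C) (d / D)) ⌊5 / 4 * C⌋₊ ⌊5 / 4 * D⌋₊ N' R S B‖
      ≤ max K₀ 0 * (P ^ ε * Ic * lemma1Norm N' R S B) + max K 0 * (P ^ ε * Ic * lemma1Norm N' R S B) +
          2 * 4 ^ ε * max Kt 0 * (P ^ ε * Ic * lemma1Norm N' R S B) := by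
        linarith [htri, hA, hBoff, hCtail]
    _ = (max K 0 + max K₀ 0 + 2 * 4 ^ ε * max Kt 0) * P ^ ε * Ic * lemma1Norm N' R S B := by ring

end L1

/-- **`BFI.K1HalfFor BFI.plateau2 (5/4)` from the off-diagonal Kloosterman sums at `s = 1` alone**:
the `S = 1/2` instance of the corrected Lemma 1 for `w ⊗ w` follows from the bound for
`BFI.L1.Koff C D N R (1/2) H₀ B` (level-`r` Kloosterman sums `S(h, n r̄; c)`, `(c, r) = 1`), by
`BFI.L1.norm_dispK_le_of_offdiag_at` at `S = 1/2` and `D²NR ≤ D²NR/(1/2)`.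
[cite: BombieriFriedlanderIwaniec2019, §2 Lemma 2.1; BombieriFriedlanderIwaniecActa1986, §8 p. 227] -/
theorem k1HalfFor_of_offdiag_half
    (hoff : ∀ ε : ℝ, 0 < ε → ∃ K : ℝ, ∀ C D N R : ℝ, 1 ≤ C → 1 ≤ D → 1 ≤ N → 1 / 2 ≤ R →
      ∀ B : ℕ → ℕ → ℕ → ℂ,
        ‖L1.Koff C D ⌊N⌋₊ R (1 / 2) ⌈2 * (C * D * N * R * (1 / 2)) ^ ε * (1 / 2) * C / D⌉₊ B‖ ≤
          K * (C * D * N * R * (1 / 2)) ^ ε *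
            Real.sqrt (C * (1 / 2) * (R * (1 / 2) + N) * (C + D * R) +
              C ^ 2 * D * (1 / 2) * Real.sqrt ((R * (1 / 2) + N) * R)) *
            lemma1Norm ⌊N⌋₊ R (1 / 2) B) :
    K1HalfFor plateau2 (5 / 4) := by
  intro ε hε
  obtain ⟨K', h⟩ := L1.norm_dispK_le_of_offdiag_at (S := 1 / 2) le_rfl hoff hε
  refine ⟨max K' 0, fun C D N R hC hD hN hR B => (h C D N R hC hD hN hR B).trans ?_⟩
  have hD0 : 0 < D := by linarith
  have hP : 0 ≤ (C * D * N * R * (1 / 2)) ^ ε := Real.rpow_nonneg (by positivity) _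
  have hnB : 0 ≤ lemma1Norm ⌊N⌋₊ R (1 / 2) B := Real.sqrt_nonneg _
  have hI : Real.sqrt (C * (1 / 2) * (R * (1 / 2) + N) * (C + D * R) +
      C ^ 2 * D * (1 / 2) * Real.sqrt ((R * (1 / 2) + N) * R) + D ^ 2 * N * R) ≤ lemma1I C D N R (1 / 2) := by
    unfold lemma1I
    refine Real.sqrt_le_sqrt ?_
    have h1 : D ^ 2 * N * R ≤ D ^ 2 * N * R / (1 / 2) := by
      rw [le_div_iff₀ (by norm_num : (0 : ℝ) < 1 / 2)]
      have : 0 ≤ D ^ 2 * N * R := by positivity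
      nlinarith
    linarith
  have hI0 : 0 ≤ Real.sqrt (C * (1 / 2) * (R * (1 / 2) + N) * (C + D * R) +
      C ^ 2 * D * (1 / 2) * Real.sqrt ((R * (1 / 2) + N) * R) + D ^ 2 * N * R) := Real.sqrt_nonneg _
  calc K' * (C * D * N * R * (1 / 2)) ^ ε *
        Real.sqrt (C * (1 / 2) * (R * (1 / 2) + N) * (C + D * R) +
          C ^ 2 * D * (1 / 2) * Real.sqrt ((R * (1 / 2) + N) * R) + D ^ 2 * N * R) * lemma1Norm ⌊N⌋₊ R (1 / 2) B
      ≤ max K' 0 * (C * D * N * R * (1 / 2)) ^ ε *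
        Real.sqrt (C * (1 / 2) * (R * (1 / 2) + N) * (C + D * R) +
          C ^ 2 * D * (1 / 2) * Real.sqrt ((R * (1 / 2) + N) * R) + D ^ 2 * N * R) * lemma1Norm ⌊N⌋₊ R (1 / 2) B := by
        gcongr
        exact le_max_left _ _
    _ ≤ max K' 0 * (C * D * N * R * (1 / 2)) ^ ε * lemma1I C D N R (1 / 2) * lemma1Norm ⌊N⌋₊ R (1 / 2) B := by
        gcongr

end BFI

open BFI

section Consequences

variable
  (hoff : ∀ ε : ℝ, 0 < ε → ∃ K : ℝ, ∀ C D N R : ℝ, 1 ≤ C → 1 ≤ D → 1 ≤ N → 1 / 2 ≤ R →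
    ∀ B : ℕ → ℕ → ℕ → ℂ,
      ‖BFI.L1.Koff C D ⌊N⌋₊ R (1 / 2) ⌈2 * (C * D * N * R * (1 / 2)) ^ ε * (1 / 2) * C / D⌉₊ B‖ ≤
        K * (C * D * N * R * (1 / 2)) ^ ε *
          Real.sqrt (C * (1 / 2) * (R * (1 / 2) + N) * (C + D * R) +
            C ^ 2 * D * (1 / 2) * Real.sqrt ((R * (1 / 2) + N) * R)) *
          BFI.lemma1Norm ⌊N⌋₊ R (1 / 2) B)
include hoff

/-- **BFI 1986, Theorem 1 (§8, p. 225) from the off-diagonal Kloosterman sums of level `r`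
(`s = 1`) alone.** [cite: BombieriFriedlanderIwaniecActa1986, §8 Theorem 1 p. 225; BombieriFriedlanderIwaniec2019, §2 Lemma 2.1] -/
theorem BombieriFriedlanderIwaniecTheorem1_of_offdiag_half : BombieriFriedlanderIwaniecTheorem1 :=
  BombieriFriedlanderIwaniecTheorem1_of_k1Half (k1HalfFor_of_offdiag_half hoff)

/-- **BFI 1986, Theorem 5 (§12, p. 237) from the same `s = 1` off-diagonal bound.**
[cite: BombieriFriedlanderIwaniecActa1986, §12 Theorem 5 p. 237] -/
theorem BombieriFriedlanderIwaniecTheorem5_of_offdiag_half : BombieriFriedlanderIwaniecTheorem5 :=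
  BombieriFriedlanderIwaniecTheorem5_of_k1Half (k1HalfFor_of_offdiag_half hoff)

/-- **BFI 1986, Theorem 10 (p. 209) from the same `s = 1` off-diagonal bound** (through
`BombieriFriedlanderIwaniecTheorem10_of_k1Half`). [cite: BombieriFriedlanderIwaniecActa1986, Theorem 10 p. 209] -/
theorem BombieriFriedlanderIwaniecTheorem10_of_offdiag_half : BombieriFriedlanderIwaniecTheorem10 :=
  BombieriFriedlanderIwaniecTheorem10_of_k1Half (k1HalfFor_of_offdiag_half hoff)

/-- **The tree's fact `bfi_wellFactorable_level` from the same `s = 1` off-diagonal bound.**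
[cite: BombieriFriedlanderIwaniecActa1986, Theorem 10 p. 209] -/
theorem bfi_wellFactorable_level_of_offdiag_half : bfi_wellFactorable_level :=
  bfi_wellFactorable_level_of_theorem10 (BombieriFriedlanderIwaniecTheorem10_of_offdiag_half hoff)

/-- **The twin-prime sieve bound `twinSieve_bfi` from the same `s = 1` off-diagonal bound**
(through `twinSieve_bfi_of_k1Half`). [cite: BombieriFriedlanderIwaniecActa1986, Theorem 10 p. 209] -/
theorem twinSieve_bfi_of_offdiag_half : twinSieve_bfi :=
  twinSieve_bfi_of_k1Half (k1HalfFor_of_offdiag_half hoff)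

end Consequences

end Literature.NumberTheory.Sieve
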